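import Literature.MathematicalPhysics.QuantumFieldTheory.Balaban1983to89.B9Eq319QprimeTowerLipschitzL2
import Literature.MathematicalPhysics.QuantumFieldTheory.Balaban1983to89.B9Eq319QprimeTowerFlatSection

/-!
# `Balaban1983to89.B9Eq319QprimeTowerNeumannSection` — T. Bałaban, *Propagators for lattice gauge theories in a background field*, Commun. Math. Phys.
# **99** (1985) 389–434 [Balaban1985BackgroundPropagators] (3.19) p. 393, p. 403 («satisfy the same bounds»), (3.79)–(3.81) p. 406, with (3.11) p. 392:
# **A VOLUME-FREE RIGHT INVERSE OF THE COMPOSITE GAUGE-PARAMETER AVERAGING `Q′_k(U)` AT A SMALL BACKGROUND, BY A NEUMANN SERIES** —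
# `S_U := S♭_k ∘ (1 + E)⁻¹`, `E := (Q′_k(U) − Q′_k(1)) ∘ S♭_k` on `ℓ²(T_m; W)`, `‖E‖ ≤ ρ̂ := Π_{j<k}(1 + 2M_φM_φ′ε_j)^{d(L−1)} − 1 < 1` ⇒ `Q′_k(U) ∘ S_U = id` and
# `‖S_U f‖_{L²(c₀)} ≤ √(c₀L^{kd})·(1 − ρ̂)⁻¹·√(Σ_y‖f y‖²)` — NO `#T_m`, NO `L^{kd∕2}`: the host's `S₂` slot without the centre extension's `CS = L^{kd∕2}√#T_m`

statement-level skeleton of published theorems with citation tags; proofs where landed; nothing here is a claim about the Yang–Mills mass gap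

PDF held: `paper:balaban1985-cmp99-background-propagators` (journal page = PDF page + 388) p. 393 (text layer p0005, read by this seat 2026-08-22) — print uses only «Q′
onto» and `(Q′G′²Q′*)⁻¹` (3.25); a right inverse of `Q′(U)` is NOT in print: this is the cell's [folklore] device (a perturbation of a surjection with a
bounded right inverse has a bounded right inverse — the Neumann series).

WHY THIS FILE (cell context; OFFER O-ne9leaf02-g64-3 (c) of the pub-balaban NE9 crux team).  The host `B9Thm311SmallFieldCoercivityTower.
exists_coercive_principalk_of_small_field` displays a section `S₂` of `Q′_k(U)` with a sup→`L²` constant `CS`, inhabited today by this lineage's centre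
extension (`CS = L^{kd∕2}√#T_m` along (3.11)); with the `ℓ²` tower letter `ρ′_k` (`B9Eq319QprimeTowerLipschitzL2`) and the block-constant flat section
`S♭_k` (`B9Eq319QprimeTowerFlatSection`, an `ℓ²`-isometry up to `√(c₀L^{kd})`), the operator `E = (Q′_k(U) − Q′_k(1))S♭_k` has `ℓ²→ℓ²` norm `≤ ρ̂`, free of
every volume, so for `ρ̂ < 1` the Neumann series gives a section of `Q′_k(U)` whose `ℓ²→L²(c₀)` norm is `√(c₀L^{kd})∕(1 − ρ̂)` — the `S₂` slot's inhabitant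
once the host measures the coarse datum in `ℓ²` (journal ASK (d)).

WHAT IS PROVED (sorry-free; proof lane — no `def`, no `Prop` placeholder, no inequality of the paper asserted).
* **`exists_QprimeTowerW_section_of_small`** — for the chain's displays (`‖Ū^j(b) − 1‖ ≤ ε_j`, `Ū^j(b) ∈ U1`, fibre letters `M_φ, M_φ′`) and
  `ρ̂ := Π_{j≤n}(1 + 2M_φM_φ′ε_j)^{d(L−1)} − 1 < 1`: `∃ S : (TSite d m → W) →ₗ[ℂ] SiteL2K ℂ d (towerP L m (n+1)) c₀ W` with `Q′_{n+1}(U)(S f) = f` and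
  `‖S f‖ ≤ √(c₀(L^{n+1})^d)·(1 − ρ̂)⁻¹·√(Σ_y ‖f y‖²)` (Mathlib's `Units.oneSub` on the complete operator ring of the finite-dimensional coarse `ℓ²` space,
  `tsum_geometric_le_of_norm_lt_one` for the inverse's norm).
MODEL ∕ HONEST SCOPE.  [folklore] Neumann series on landed letters; `W` finite-dimensional (the chain's fibre `W ≃ 𝔸`); the ε-displays are the gauge question;
nothing of [B9] Thms 3.1–3.13 asserted; NOT summit progress (cell pub-balaban: NE9 NOT PRINTED ∕ NOT PROVED, «NE9 ⇐ the named binders»; row WALLED ON A MODEL;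
spine PROVED 0∕9; rung (B)+1 finite T⁴ — NOT infinite volume, NOT mass gap, NOT Clay; HONEST DEPENDENCY: continuum YM on T⁴ ⇐ BetaPertH ∧ nine spine estimates
(0/9 proved); BetaPertH ⇐ (D1) ∧ (D4) ∧ CAP+tail; G-an2-4 gates asym, D1 and NE2/3/4).  Filed by the NE9 crux-team leaf seat `b2b-balaban-t4-ne9-formalise-leaf-02`
(gen 64); NEW file importing this lineage's `B9Eq319QprimeTowerLipschitzL2` and `B9Eq319QprimeTowerFlatSection`; nothing modified.  Net new unproved facts: 0.
-/

noncomputable section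

open scoped BigOperators

namespace Literature.MathematicalPhysics.QuantumFieldTheory.Balaban1983to89.B9Eq319QprimeTowerNeumannSection

open B4Sect5Torus (TSite)
open B9SectCLatticeCarrier (Bond)
open B7Prop1Explicit (U1)
open B9Eq311L2Pairing (WL2)
open B11Eq103H1Complex (SiteL2K)
open B9Eq315QTower (towerP UlevOf)
open B9Eq326OperatorTower (QprimeTowerW)
open B9Eq319QprimeTowerLipschitzL2 (sqrt_sum_norm_sq_QprimeTowerW_sub_flat_le)
open B9Eq319QprimeTowerFlatSection (exists_QprimeTowerW_one_flatSection)

variable {d : ℕ} (L : ℕ) [NeZero L] {𝔸 : Type*} [NormedRing 𝔸] [NormedAlgebra ℂ 𝔸] [CompleteSpace 𝔸] [NormOneClass 𝔸]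
  (m : Fin d → ℕ) [∀ i, NeZero (m i)] (n : ℕ)
  {W : Type*} [NormedAddCommGroup W] [InnerProductSpace ℂ W] [FiniteDimensional ℂ W] (φ : W ≃ₗ[ℂ] 𝔸) {Mφ Mφ' : ℝ} (hMφ : 0 ≤ Mφ) (hMφ' : 0 ≤ Mφ')
  (hφ : ∀ w, ‖φ w‖ ≤ Mφ * ‖w‖) (hφ' : ∀ X, ‖φ.symm X‖ ≤ Mφ' * ‖X‖) {c₀ : ℝ} [Fact (0 < c₀)]
  (U : Bond d (towerP L m (n + 1)) → 𝔸ˣ) (εU : ℕ → ℝ) (hεU : ∀ j, 0 ≤ εU j)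
  (hUε : ∀ (j : ℕ) (b : Bond d (towerP L m (j + 1))), ‖(UlevOf L m (n + 1) U j b : 𝔸) - 1‖ ≤ εU j)
  (hUb : ∀ (j : ℕ) (b : Bond d (towerP L m (j + 1))), UlevOf L m (n + 1) U j b ∈ U1 𝔸)

include hφ hφ' hMφ hMφ' hεU hUε hUb in
/-- **A VOLUME-FREE RIGHT INVERSE OF `Q′_{n+1}(U)` BY A NEUMANN SERIES**: with `ρ̂ := Π_{j≤n}(1 + 2M_φM_φ′ε_j)^{d(L−1)} − 1 < 1` there is a `ℂ`-linear
`S : (T_m → W) → L²(T_{L^{n+1}m}; c₀; W)` with `Q′_{n+1}(U)(S f) = f` and `‖S f‖ ≤ √(c₀(L^{n+1})^d)·(1 − ρ̂)⁻¹·√(Σ_y ‖f y‖²)` — `S = S♭ ∘ (1 + E)⁻¹`,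
`E = (Q′_{n+1}(U) − Q′_{n+1}(1))S♭` of `ℓ²→ℓ²` norm `≤ ρ̂` by `B9Eq319QprimeTowerLipschitzL2` and `B9Eq319QprimeTowerFlatSection`.
[cite: Balaban1985BackgroundPropagators, (3.19) p.393, p.403, (3.79)–(3.81) p.406, (3.11) p.392] -/
theorem exists_QprimeTowerW_section_of_small
    (hρ : (∏ j ∈ Finset.range (n + 1), (1 + 2 * Mφ * Mφ' * εU j) ^ (d * (L - 1))) - 1 < 1) :
    ∃ S : (TSite d m → W) →ₗ[ℂ] SiteL2K ℂ d (towerP L m (n + 1)) c₀ W,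
      (∀ f : TSite d m → W, QprimeTowerW L m n φ U (c₀ := c₀) (S f) = f) ∧
      ∀ f : TSite d m → W, ‖S f‖ ≤ Real.sqrt (c₀ * ((L : ℝ) ^ (n + 1)) ^ d) *
        (1 - ((∏ j ∈ Finset.range (n + 1), (1 + 2 * Mφ * Mφ' * εU j) ^ (d * (L - 1))) - 1))⁻¹ * Real.sqrt (∑ y : TSite d m, ‖f y‖ ^ 2) := by
  have hc₀ : 0 < c₀ := Fact.out
  have hL0 : (0 : ℝ) < L := by exact_mod_cast Nat.pos_of_ne_zero (NeZero.ne L)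
  set ρ : ℝ := (∏ j ∈ Finset.range (n + 1), (1 + 2 * Mφ * Mφ' * εU j) ^ (d * (L - 1))) - 1 with hρdef
  have hρ0 : 0 ≤ ρ := by
    rw [hρdef, sub_nonneg]
    exact Finset.one_le_prod (s := Finset.range (n + 1)) fun j _ => one_le_pow₀ (by
      have h0 : 0 ≤ 2 * Mφ * Mφ' * εU j := by have := hεU j; positivity
      linarith)
  set κ : ℝ := Real.sqrt (c₀ * ((L : ℝ) ^ (n + 1)) ^ d) with hκdef
  have hκ0 : 0 < κ := by rw [hκdef]; positivity
  have hκinv : Real.sqrt ((c₀ * ((L : ℝ) ^ (n + 1)) ^ d)⁻¹) * κ = 1 := by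
    rw [hκdef, ← Real.sqrt_mul (by positivity), inv_mul_cancel₀ (by positivity), Real.sqrt_one]
  -- the flat block-constant section
  obtain ⟨Sb, hSb, hSbmass, -⟩ := exists_QprimeTowerW_one_flatSection L (𝔸 := 𝔸) m n (W := W) (c₀ := c₀)
  have hSbnorm : ∀ h : TSite d m → W, ‖Sb h‖ = κ * Real.sqrt (∑ y, ‖h y‖ ^ 2) := fun h => by
    have h2 := hSbmass h
    have hn0 : 0 ≤ ‖Sb h‖ := norm_nonneg _
    rw [hκdef, ← Real.sqrt_mul (by positivity), ← h2, Real.sqrt_sq hn0]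
  -- the coarse `ℓ²` space (weight `1`) and the deviation operator `E = (Q′(U) − Q′(1)) ∘ S♭` on it
  haveI hfact : Fact ((0 : ℝ) < 1) := ⟨one_pos⟩
  let X := SiteL2K ℂ d m (1 : ℝ) W
  let eX : X ≃ₗ[ℂ] (TSite d m → W) := WL2.linearEquiv ℂ ℂ (fun _ : TSite d m => (1 : ℝ))
  have hXnorm : ∀ g : X, ‖g‖ = Real.sqrt (∑ y, ‖eX g y‖ ^ 2) := fun g => by
    have h := WL2.norm_sq (𝕜 := ℂ) (w := fun _ : TSite d m => (1 : ℝ)) (V := W) g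
    simp only [one_mul] at h
    show ‖g‖ = Real.sqrt (∑ y, ‖WL2.equiv ℂ (fun _ : TSite d m => (1 : ℝ)) W g y‖ ^ 2)
    rw [← h, Real.sqrt_sq (norm_nonneg _)]
  let D : (TSite d m → W) →ₗ[ℂ] (TSite d m → W) :=
    (QprimeTowerW L m n φ U (c₀ := c₀) - QprimeTowerW L m n φ (fun _ : Bond d (towerP L m (n + 1)) => (1 : 𝔸ˣ)) (c₀ := c₀)) ∘ₗ Sb
  have hD : ∀ h y, D h y = QprimeTowerW L m n φ U (c₀ := c₀) (Sb h) y -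
      QprimeTowerW L m n φ (fun _ : Bond d (towerP L m (n + 1)) => (1 : 𝔸ˣ)) (c₀ := c₀) (Sb h) y := fun h y => rfl
  let Elin : X →ₗ[ℂ] X := eX.symm.toLinearMap ∘ₗ D ∘ₗ eX.toLinearMap
  let Ec : X →L[ℂ] X := LinearMap.toContinuousLinearMap Elin
  have hEc : ∀ g : X, eX (Ec g) = D (eX g) := fun g => by
    show eX (eX.symm (D (eX g))) = D (eX g)
    exact eX.apply_symm_apply _
  -- `‖E‖ ≤ ρ̂`, volume-free
  have hEnorm : ‖Ec‖ ≤ ρ := by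
    refine ContinuousLinearMap.opNorm_le_bound _ hρ0 fun g => ?_
    rw [hXnorm (Ec g), hXnorm g]
    have h1 := sqrt_sum_norm_sq_QprimeTowerW_sub_flat_le L m n φ hMφ hMφ' hφ hφ' (c₀ := c₀) U εU hεU hUε hUb (Sb (eX g))
    have h2 : Real.sqrt (∑ y, ‖eX (Ec g) y‖ ^ 2) = Real.sqrt (∑ y, ‖QprimeTowerW L m n φ U (c₀ := c₀) (Sb (eX g)) y -
        QprimeTowerW L m n φ (fun _ : Bond d (towerP L m (n + 1)) => (1 : 𝔸ˣ)) (c₀ := c₀) (Sb (eX g)) y‖ ^ 2) := by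
      simp only [hEc, hD]
    rw [h2]
    refine h1.trans (le_of_eq ?_)
    rw [hSbnorm, ← hρdef]
    calc ρ * (Real.sqrt ((c₀ * ((L : ℝ) ^ (n + 1)) ^ d)⁻¹) * (κ * Real.sqrt (∑ y, ‖eX g y‖ ^ 2)))
        = ρ * ((Real.sqrt ((c₀ * ((L : ℝ) ^ (n + 1)) ^ d)⁻¹) * κ) * Real.sqrt (∑ y, ‖eX g y‖ ^ 2)) := by ring
      _ = ρ * Real.sqrt (∑ y, ‖eX g y‖ ^ 2) := by rw [hκinv, one_mul]
  -- the Neumann series: `1 + E` is a unit of the complete operator ring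
  have hneg : ‖-Ec‖ < 1 := by rw [norm_neg]; exact hEnorm.trans_lt hρ
  let u := Units.oneSub (-Ec) hneg
  have hu : (↑u : X →L[ℂ] X) = 1 + Ec := by show 1 - -Ec = 1 + Ec; rw [sub_neg_eq_add]
  let T : X →L[ℂ] X := ↑u⁻¹
  have hTsec : ∀ x : X, T x + Ec (T x) = x := fun x => by
    have h := congrArg (fun A : X →L[ℂ] X => A x) u.mul_inv
    rw [hu] at h
    exact h
  have hTnorm : ‖T‖ ≤ (1 - ρ)⁻¹ := by
    have h1 : ‖(1 : X →L[ℂ] X)‖ ≤ 1 := ContinuousLinearMap.norm_id_le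
    have h2 := tsum_geometric_le_of_norm_lt_one (-Ec) hneg
    have h3 : (1 - ‖-Ec‖)⁻¹ ≤ (1 - ρ)⁻¹ := by
      rw [norm_neg]
      exact inv_anti₀ (by linarith) (by linarith)
    calc ‖T‖ = ‖∑' k : ℕ, (-Ec) ^ k‖ := rfl
      _ ≤ ‖(1 : X →L[ℂ] X)‖ - 1 + (1 - ‖-Ec‖)⁻¹ := h2
      _ ≤ (1 - ρ)⁻¹ := by linarith
  -- the section
  let S : (TSite d m → W) →ₗ[ℂ] SiteL2K ℂ d (towerP L m (n + 1)) c₀ W :=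
    Sb ∘ₗ eX.toLinearMap ∘ₗ (T : X →L[ℂ] X).toLinearMap ∘ₗ eX.symm.toLinearMap
  have hS : ∀ f, S f = Sb (eX (T (eX.symm f))) := fun f => rfl
  refine ⟨S, fun f => ?_, fun f => ?_⟩
  · -- `Q′(U) S♭ h = h + D h`, and `h + D h = eX((1 + E) T x) = eX x = f`
    rw [hS]
    set x : X := eX.symm f with hx
    have hsplit : QprimeTowerW L m n φ U (c₀ := c₀) (Sb (eX (T x))) = eX (T x) + D (eX (T x)) := by
      funext y
      rw [Pi.add_apply, hD, hSb φ (eX (T x))]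
      abel
    rw [hsplit, ← hEc, ← map_add, hTsec x, hx]
    exact eX.apply_symm_apply f
  · rw [hS, hSbnorm, ← hXnorm]
    have hx : ‖eX.symm f‖ = Real.sqrt (∑ y, ‖f y‖ ^ 2) := by
      rw [hXnorm]
      exact congrArg Real.sqrt (Finset.sum_congr rfl fun y _ => by rw [LinearEquiv.apply_symm_apply])
    calc κ * ‖T (eX.symm f)‖ ≤ κ * (‖T‖ * ‖eX.symm f‖) := mul_le_mul_of_nonneg_left (T.le_opNorm _) hκ0.le
      _ ≤ κ * ((1 - ρ)⁻¹ * ‖eX.symm f‖) := mul_le_mul_of_nonneg_left (mul_le_mul_of_nonneg_right hTnorm (norm_nonneg _)) hκ0.le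
      _ = κ * (1 - ρ)⁻¹ * Real.sqrt (∑ y, ‖f y‖ ^ 2) := by rw [hx, mul_assoc]

end Literature.MathematicalPhysics.QuantumFieldTheory.Balaban1983to89.B9Eq319QprimeTowerNeumannSection

end
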